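import Summits.CriticalPhenomena.PercolationContinuityZ3.Theorems.PercNearOneGluingNoHeavyLowerTailSahiCTCRtThreeSlots
import Summits.CriticalPhenomena.PercolationContinuityZ3.Theorems.PercNearOneGluingNoHeavyLowerTailSahiCTCRtThreeDiagonalBase
import HarnessLib

/-!
# `NoHeavyLowerTail` (crux stmt-CriticalPhenomena-4575), P3 lane: the squarefree row of `R_3 ∈ ℕ[s]` for every number of points follows from
# the VERTEX-DELETION DROP `[s^W] R_3 ≥ [s^{W−v}] R_3` (memo g49 §3: conjecture (MONO), 0 failures; the drop is K_k-extremal, `= 2k` there)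

Support file (seat `prim-l12-p3`, gen 49; `--supports stmt-CriticalPhenomena-4575`).  Memo
`run/shared/lean/prim/prim-l12/FROM-prim-l12-p3-g49-PIVOT-BUDGET.md` §3.

For a pair of families `F, G` and a finset `W`, `[s^W] R_3(F,G)` only involves the members inside `W`, so `[s^{W−v}] R_3(F,G)` is the squarefree
coefficient of the pair restricted to `W ∖ {v}`.  The row-0 DROP at `v` is `[s^W] R_3 − [s^{W−v}] R_3` (memo g45's `C1` at the squarefree profile).
* **`coeff_ind_Rt_three_nonneg_of_drop`** : for a loop-free pair of up-sets on `V`: if every `W ⊆ V` with `8 ≤ #W` has a vertex `v ∈ W` with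
  nonnegative drop, then `[s^V] R_3(𝒳,𝒵) ≥ 0` — induction on `#W` from `coeff_ind_Rt_three_nonneg_of_card_le_seven` (…SahiCTCRtThreeSlots).
* **`coeff_Rt_three_nonneg_of_dropLow`** : ALL PROFILES — if at every low profile (entries `≤ 2`, at most two doubled points, a single point, all
  single points loop-free) of every pair of up-sets some single point `s` has `coeff_{n − e_s} R_3 ≤ coeff_n R_3` (the drop `C1 ≥ 0` of memo g44),
  then `R_3(𝒳,𝒵) ∈ ℕ[s]` for every pair — by induction on the number of single points inside `coeff_Rt_three_nonneg_of_loopFree'`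
  (…SahiCTCRtThreeDiagonalBase; profiles without single points and `≤ 2` doubled points vanish by `coeff_Rt_three_eq_zero_of_card_support_le_two`).
Nothing is asserted about the crux; the drop hypotheses are open (memo g49 §3: 0 failures in 7.4·10⁷ (pair, profile, point) tests at 7–10 points, rows
with ≤ 2 doubled points, kit j302094; row 0: the minimum drop over all points is exactly `2k` (the `K_k` value) in every annealed run, kit j301893).
-/

noncomputable section

open scoped Classical

namespace Summit.CriticalPhenomena.PercolationContinuityZ3.Theorems.SahiCTCForms

open Finset MvPolynomial SahiCTCGenFun

variable {α : Type*} [DecidableEq α] [Fintype α]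

section Drop
variable {F G : Finset (Finset α)}

/-- **ROW 0 ⟸ (MONO).**  For a loop-free pair of up-sets on `V`: if for every `W ⊆ V` with at least eight points some vertex `v ∈ W` has
`[s^{W ∖ {v}}] R_3 ≤ [s^W] R_3`, then `[s^V] R_3(𝒳,𝒵) ≥ 0`.  (Base: `coeff_ind_Rt_three_nonneg_of_card_le_seven`.) [this work] -/
theorem coeff_ind_Rt_three_nonneg_of_drop (hF : IsUpperSet (F : Set (Finset α))) (hG : IsUpperSet (G : Set (Finset α)))
    (V : Finset α) (h0F : ∅ ∉ F) (h0G : ∅ ∉ G) (h1F : ∀ v ∈ V, ({v} : Finset α) ∉ F) (h1G : ∀ v ∈ V, ({v} : Finset α) ∉ G)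
    (hdrop : ∀ W ⊆ V, 8 ≤ #W → ∃ v ∈ W, (Rt 3 F G).coeff (ind (W.erase v)) ≤ (Rt 3 F G).coeff (ind W)) :
    0 ≤ (Rt 3 F G).coeff (ind V) := by
  -- strong induction on the number of points of `W ⊆ V`
  suffices h : ∀ (n : ℕ) (W : Finset α), W ⊆ V → #W ≤ n → 0 ≤ (Rt 3 F G).coeff (ind W) from h (#V) V Subset.rfl le_rfl
  intro n
  induction n with
  | zero =>
    intro W hWV hW
    exact coeff_ind_Rt_three_nonneg_of_card_le_seven hF hG W (by omega) h0F h0G (fun v hv => h1F v (hWV hv)) (fun v hv => h1G v (hWV hv))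
  | succ n ih =>
    intro W hWV hW
    by_cases h7 : #W ≤ 7
    · exact coeff_ind_Rt_three_nonneg_of_card_le_seven hF hG W h7 h0F h0G (fun v hv => h1F v (hWV hv)) (fun v hv => h1G v (hWV hv))
    · obtain ⟨v, hvW, hv⟩ := hdrop W hWV (by omega)
      have hcard : #(W.erase v) ≤ n := by rw [card_erase_of_mem hvW]; omega
      exact le_trans (ih (W.erase v) ((erase_subset v W).trans hWV) hcard) hv

/-- **`R_3 ∈ ℕ[s]` ⟸ THE DROP AT LOW PROFILES.**  If for every pair of up-sets and every profile `n` with entries `≤ 2`, at most two doubled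
points, at least one single point and all single points loop-free, some single point `s` of `n` satisfies `coeff_{n − e_s} R_3 ≤ coeff_n R_3`,
then every coefficient of `R_3(𝒳,𝒵)` is nonnegative for every pair of up-sets. [this work] -/
theorem coeff_Rt_three_nonneg_of_dropLow
    (hD : ∀ (F G : Finset (Finset α)), IsUpperSet (F : Set (Finset α)) → IsUpperSet (G : Set (Finset α)) →
      ∀ (n : α →₀ ℕ), (∀ i, n i ≤ 2) → #(dbl n) ≤ 2 → (∃ s, n s = 1) →
        (∀ u, n u = 1 → ({u} : Finset α) ∉ F ∧ ({u} : Finset α) ∉ G) →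
        ∃ s, n s = 1 ∧ (Rt 3 F G).coeff (n - Finsupp.single s 1) ≤ (Rt 3 F G).coeff n)
    {F G : Finset (Finset α)} (hF : IsUpperSet (F : Set (Finset α))) (hG : IsUpperSet (G : Set (Finset α))) (n : α →₀ ℕ) :
    0 ≤ (Rt 3 F G).coeff n := by
  refine coeff_Rt_three_nonneg_of_loopFree' (fun F' G' hF' hG' => ?_) hF hG n
  -- induction on the number of single points
  suffices key : ∀ (k : ℕ) (m : α →₀ ℕ), #(m.support.filter fun i => m i = 1) ≤ k → (∀ i, m i ≤ 2) → #(dbl m) ≤ 2 →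
      (∃ s, m s = 1) → (∀ u, m u = 1 → ({u} : Finset α) ∉ F' ∧ ({u} : Finset α) ∉ G') → 0 ≤ (Rt 3 F' G').coeff m from
    fun m hm hd hs hl => key _ m le_rfl hm hd hs hl
  intro k
  induction k with
  | zero =>
    intro m hk _ _ hs _
    obtain ⟨s, hs⟩ := hs
    have hsmem : s ∈ m.support.filter fun i => m i = 1 :=
      mem_filter.2 ⟨Finsupp.mem_support_iff.2 (by rw [hs]; exact one_ne_zero), hs⟩
    have hpos := card_pos.2 ⟨s, hsmem⟩
    omega
  | succ k ih =>
    intro m hk hm hd hs hl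
    obtain ⟨s, hs1, hdrop⟩ := hD F' G' hF' hG' m hm hd hs hl
    refine le_trans ?_ hdrop
    set m' := m - Finsupp.single s 1 with hm'
    have hm's : m' s = 0 := by rw [hm', Finsupp.tsub_apply, Finsupp.single_eq_same, hs1]
    have hm'i : ∀ i, i ≠ s → m' i = m i := fun i hi => by
      rw [hm', Finsupp.tsub_apply, Finsupp.single_apply, if_neg (Ne.symm hi), Nat.sub_zero]
    have hm'le : ∀ i, m' i ≤ 2 := fun i => by
      by_cases hi : i = s
      · rw [hi, hm's]; omega
      · rw [hm'i i hi]; exact hm i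
    have hdbl : dbl m' = dbl m := by
      ext i; unfold dbl
      simp only [mem_filter, Finsupp.mem_support_iff]
      by_cases hi : i = s
      · subst hi; rw [hm's, hs1]; omega
      · rw [hm'i i hi]
    have hl' : ∀ u, m' u = 1 → ({u} : Finset α) ∉ F' ∧ ({u} : Finset α) ∉ G' := fun u hu => by
      by_cases hus : u = s
      · subst hus; rw [hm's] at hu; omega
      · exact hl u (by rw [← hm'i u hus]; exact hu)
    have hsingles : (m'.support.filter fun i => m' i = 1) = (m.support.filter fun i => m i = 1).erase s := by
      ext i
      simp only [mem_filter, mem_erase, Finsupp.mem_support_iff]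
      by_cases hi : i = s
      · subst hi; rw [hm's]; simp
      · rw [hm'i i hi]; tauto
    have hsmem : s ∈ m.support.filter fun i => m i = 1 :=
      mem_filter.2 ⟨Finsupp.mem_support_iff.2 (by rw [hs1]; exact one_ne_zero), hs1⟩
    have hcard : #(m'.support.filter fun i => m' i = 1) ≤ k := by
      have h1 := card_erase_of_mem hsmem
      rw [hsingles, h1]; omega
    by_cases hs' : ∃ t, m' t = 1
    · exact ih m' hcard hm'le (by rw [hdbl]; exact hd) hs' hl'
    · -- no single point left: the support is the set of doubled points, of size ≤ 2
      have hs'' : ∀ t, m' t ≠ 1 := fun t ht => hs' ⟨t, ht⟩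
      have hsupp : m'.support = dbl m' := by
        ext i; unfold dbl
        simp only [mem_filter, Finsupp.mem_support_iff]
        constructor
        · intro h; have h2 := hm'le i; have h1 := hs'' i; exact ⟨h, by omega⟩
        · exact fun h => h.1
      rw [coeff_Rt_three_eq_zero_of_card_support_le_two F' G' (by rw [hsupp, hdbl]; exact hd)]

end Drop

end Summit.CriticalPhenomena.PercolationContinuityZ3.Theorems.SahiCTCForms
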